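import Literature.NumberTheory.EllipticCurves.QuadraticTwistIntegralModelSigmaSqProofs
import Literature.NumberTheory.EllipticCurves.VariableChangePoints
import Literature.NumberTheory.EllipticCurves.CanonicalPAdicHeightRestrictionProofs
import HarnessLib

/-!
# Pinning the canonical `2`-adic height on the minus part of a quadratic twist: a height datum on
# `V^{(d)}(ℚ)` equal to `canonicalPAdicHeightSqMinusTwist` (proofs only)

Topic `Literature/NumberTheory/EllipticCurves` (trunk T-NT-EC). Pure proof file (no definition, no
named fact), sequel of `QuadraticTwistIntegralModelSigmaSqProofs.lean` and consumer of the receptacle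
`PAdicHeightData.IsCanonicalSqMinusTwist` (`PadicSigmaSqMinusTwist.lean`, typer ty2 g49). Width seat
`bsd-line-cf2-p1-w5` (g20) of the cell `bsd-print-cf2`, in support of stmt-BirchSwinnertonDyer-20368
(road (C) `disegni-pair-two`; this is the existence half of the re-cut's `stub_pin_minusTwist_two` /
ty2's residue (R1): «PINNING/NON-VACUITY of `IsCanonicalSqMinusTwist` on the `j = −3375` twists»).
BSD is not proved by any of this.

## Result

For `V/ℚ` elliptic with `ℤ`-integral equation such that `V ⊗ ℚ₂` carries a sigma-squared pair (every
curve good ordinary at `2` under Silverman's Rem. 2; binder-free for `49a1` and its twists,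
`cm7Twist_exists_isMazurTateSigmaSqPair_two`) and `d ∈ {−1, 2, −2}`:

* `exists_padicHeightData_eq_canonicalPAdicHeightSqMinusTwist` — there is `D : PAdicHeightData
  (V.quadraticTwist d) 2` with `⟨P,P⟩_D = canonicalPAdicHeightSqMinusTwist V 2 d P` for every point
  `P = (X, Y)` satisfying the receptacle's local conditions and `‖4X‖₂ > 1`;
* `exists_isCanonicalSqMinusTwist_neg_one` — **for `d = −1` the extra condition is automatic, so
  `∃ D, D.IsCanonicalSqMinusTwist`**: the receptacle at `d = −1` is inhabited, and every
  `∀ D, IsCanonicalSqMinusTwist D → …` statement there (Bertrand's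
  `bertrand_pairingSqMinusTwist_self_ne_zero_two`) is about an object that exists.

For `d = ±2` the receptacle's admissible locus (`ord₂ x(P′) ≤ −3`) exceeds the locus reached here
(`ord₂ x(P′) ≤ −4`, i.e. `(4X, 8Y)` in the formal group `Ŵ(2ℤ₂)` of the integral twist model) by the
BOUNDARY `ord₂ x(P′) = −3`, where `(4X, 8Y)` reduces to the smooth point of the cuspidal fibre of `W` and
lies in no `ℚ₂`-formal group; closing it needs one more identity (the `x`-only duplication formula
`𝔖₂(1/x(2P′))·… = ψ₂²(x′)·𝔖₂(1/x′)⁴` evaluated in `ℚ₂`) — NOT in this file.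

## Method (no `2`-adic analysis over `ℚ₂(√d)`)

§1 bookkeeping: `log₂(4d) = 0`, `den(X₁/(4d)) = 4|d|·den X₁` for `‖X₁‖₂ > 1`, hence
`log₂ den x(P′) = log₂ den X₁`. §2 the receptacle's odd-prime conditions on `x′ = X₁/(4d)` give
non-singular reduction of `(X₁, Y₁)` on the integral twist model `W` (`Φ_x = −16d²f′(x′)`, `Φ_y = 2Y₁`,
`Y₁² = 64d³f(x′)`). §3 `W ⊗ ℚ₂` carries the sigma-squared pair `((4d)⁻¹𝔖₂(4d/x), 4dc)`
(`isMazurTateSigmaSqPair_twistModel_padicSigmaSqInvX`), its `Σ`-height admits a height datum on the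
reduction-kernel locus (`exists_padicHeightData_of_pair_of_a₁_a₃`, `a₁ = a₃ = 0`), that `Σ`-height IS the
receptacle formula there (value dictionary + §1), and the datum is transported along
`(X, Y) ↦ (4X, 8Y)` (`VariableChange.pointEquiv`).

## Sources

* B. Mazur, W. Stein, J. Tate, Doc. Math. Extra Vol. Coates (2006), §1 eq. (1.1), §2.7. [MazurSteinTate2006]
* J. H. Silverman, Math. Ann. 332 (2005), §5 Rem. 2. [Silverman2005DivPoly]
* J. Balakrishnan, M. Çiperiani, W. Stein, Math. Comp. 84 (2015), §4.1 (4.1). [BalakrishnanCiperianiStein2015]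
* K. Iwasawa, *Lectures on p-adic L-functions* (1972), §4.4 (`log_p p = 0`). [Iwasawa1972PadicL]
* J. H. Silverman, *The Arithmetic of Elliptic Curves*, 2nd ed. (2009), III.1, VII.2, VII.3.4. [SilvermanAEC2009]
-/

noncomputable section

open scoped Classical
open PowerSeries Literature.NumberTheory.EllipticCurves

namespace WeierstrassCurve

/-! ### §1 `2`-adic bookkeeping for `d ∈ {−1, 2, −2}`: `log₂(4d) = 0`, `den(X₁/(4d)) = 4|d|·den X₁` -/

section Bookkeeping

/-- `log₂ 4 = log₂ 8 = 0` (Iwasawa normalisation `log₂ 2 = 0`). [cite: Iwasawa1972PadicL, §4.4] -/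
theorem padicLog_four_eq_zero_and_eight :
    padicLog 2 (4 : ℚ_[2]) = 0 ∧ padicLog 2 (8 : ℚ_[2]) = 0 := by
  have hmul : padicLog_mul 2 := padicLog_mul_holds 2
  have h2 : padicLog 2 (2 : ℚ_[2]) = 0 := by exact_mod_cast padicLog_natCast_self_holds 2
  have h20 : (2 : ℚ_[2]) ≠ 0 := two_ne_zero
  have h4 : padicLog 2 (4 : ℚ_[2]) = 0 := by
    rw [show (4 : ℚ_[2]) = 2 * 2 by norm_num, hmul h20 h20, h2, add_zero]
  refine ⟨h4, ?_⟩
  rw [show (8 : ℚ_[2]) = 4 * 2 by norm_num, hmul (by norm_num) h20, h4, h2, add_zero]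

/-- `log₂(4d) = 0` for `d ∈ {−1, 2, −2}` (`log₂ 2 = 0`, `log₂(−1) = 0`). [cite: Iwasawa1972PadicL, §4.4] -/
theorem padicLog_four_mul_eq_zero {d : ℤ} (hd : d = -1 ∨ d = 2 ∨ d = -2) :
    padicLog 2 (4 * (d : ℚ_[2])) = 0 := by
  have hmul : padicLog_mul 2 := padicLog_mul_holds 2
  obtain ⟨h4, h8⟩ := padicLog_four_eq_zero_and_eight
  have hm1 : padicLog 2 (-1 : ℚ_[2]) = 0 := padicLog_neg_one 2
  rcases hd with rfl | rfl | rfl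
  · push_cast
    rw [hmul (by norm_num) (by norm_num), h4, hm1, add_zero]
  · push_cast
    rw [show (4 : ℚ_[2]) * 2 = 8 by norm_num, h8]
  · push_cast
    rw [show (4 : ℚ_[2]) * -2 = -1 * 8 by norm_num, hmul (by norm_num) (by norm_num), hm1, h8, add_zero]

/-- `log₂((4d)⁻¹·v) = log₂ v` for `d ∈ {−1, 2, −2}`, `v ≠ 0`. [cite: Iwasawa1972PadicL, §4.4] -/
theorem padicLog_inv_four_mul_mul {d : ℤ} (hd : d = -1 ∨ d = 2 ∨ d = -2) {v : ℚ_[2]} (hv : v ≠ 0) :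
    padicLog 2 ((4 * (d : ℚ_[2]))⁻¹ * v) = padicLog 2 v := by
  have hmul : padicLog_mul 2 := padicLog_mul_holds 2
  have hd0 : (4 * (d : ℚ_[2])) ≠ 0 := by
    rcases hd with rfl | rfl | rfl <;> norm_num
  have hinv : padicLog 2 (4 * (d : ℚ_[2]))⁻¹ = 0 := by
    have h := hmul hd0 (inv_ne_zero hd0)
    rw [mul_inv_cancel₀ hd0, padicLog_one, padicLog_four_mul_eq_zero hd, zero_add] at h
    exact h.symm
  rw [hmul (inv_ne_zero hd0) hv, hinv, zero_add]

/-- **`den(X₁/(4d)) = 4|d|·den(X₁)` for `d ∈ {−1, 2, −2}` and `X₁` with even denominator** (then the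
numerator of `X₁` is odd, hence prime to `4d`). [folklore] [cite: SilvermanAEC2009, VII.3.4] -/
theorem den_div_four_div_eq {d : ℤ} (hd : d = -1 ∨ d = 2 ∨ d = -2) {X₁ : ℚ} (h2 : 2 ∣ X₁.den) :
    (X₁ / 4 / (d : ℚ)).den = 4 * d.natAbs * X₁.den := by
  have hnum : ¬ (2 : ℤ) ∣ X₁.num := not_dvd_num_of_dvd_den Nat.prime_two h2
  have hcop : X₁.num.natAbs.Coprime X₁.den := X₁.reduced
  have hodd : X₁.num.natAbs.Coprime 2 := by
    rw [Nat.coprime_two_right, Nat.odd_iff]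
    rcases Int.emod_two_eq_zero_or_one X₁.num with h | h
    · exact absurd (Int.dvd_of_emod_eq_zero h) hnum
    · omega
  have hden0 : (0 : ℤ) < X₁.den := by exact_mod_cast X₁.den_pos
  -- `X₁ / 4 / d = (±num) / (2^k den)` in lowest terms
  have key : ∀ (k : ℕ) (ε : ℤ), (ε = 1 ∨ ε = -1) →
      (((ε * X₁.num : ℤ) : ℚ) / ((2 ^ k * X₁.den : ℤ) : ℚ)).den = 2 ^ k * X₁.den := by
    intro k ε hε
    have hb : (0 : ℤ) < 2 ^ k * X₁.den := mul_pos (pow_pos two_pos k) hden0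
    have hc : (ε * X₁.num).natAbs.Coprime (2 ^ k * (X₁.den : ℤ)).natAbs := by
      have hεabs : (ε * X₁.num).natAbs = X₁.num.natAbs := by
        rcases hε with rfl | rfl <;> simp
      rw [hεabs, Int.natAbs_mul, Int.natAbs_pow, Int.natAbs_natCast]
      exact Nat.Coprime.mul_right (Nat.Coprime.pow_right k hodd) hcop
    have := Rat.den_div_eq_of_coprime hb hc
    exact_mod_cast this
  have hX : X₁ = (X₁.num : ℚ) / (X₁.den : ℚ) := (Rat.num_div_den X₁).symm
  have hd0' : (X₁.den : ℚ) ≠ 0 := by exact_mod_cast X₁.den_nz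
  rcases hd with rfl | rfl | rfl
  · have e : X₁ / 4 / ((-1 : ℤ) : ℚ) = (((-1) * X₁.num : ℤ) : ℚ) / ((2 ^ 2 * X₁.den : ℤ) : ℚ) := by
      conv_lhs => rw [hX]
      push_cast; field_simp; try ring
    rw [e, key 2 (-1) (Or.inr rfl)]; norm_num
  · have e : X₁ / 4 / ((2 : ℤ) : ℚ) = (((1 : ℤ) * X₁.num : ℤ) : ℚ) / ((2 ^ 3 * X₁.den : ℤ) : ℚ) := by
      conv_lhs => rw [hX]
      push_cast; field_simp; try ring
    rw [e, key 3 1 (Or.inl rfl)]; norm_num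
  · have e : X₁ / 4 / ((-2 : ℤ) : ℚ) = (((-1) * X₁.num : ℤ) : ℚ) / ((2 ^ 3 * X₁.den : ℤ) : ℚ) := by
      conv_lhs => rw [hX]
      push_cast; field_simp; try ring
    rw [e, key 3 (-1) (Or.inr rfl)]; norm_num

/-- **`log₂ den(X₁/(4d)) = log₂ den(X₁)`** for `d ∈ {−1, 2, −2}` and `‖X₁‖₂ > 1` (`log₂(4|d|) = 0`).
[cite: Iwasawa1972PadicL, §4.4] -/
theorem padicLog_den_div_four_div_eq {d : ℤ} (hd : d = -1 ∨ d = 2 ∨ d = -2) {X₁ : ℚ}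
    (hX : 1 < ‖(X₁ : ℚ_[2])‖) :
    padicLog 2 (((X₁ / 4 / (d : ℚ)).den : ℚ) : ℚ_[2]) = padicLog 2 ((X₁.den : ℚ) : ℚ_[2]) := by
  have hval : padicValRat 2 X₁ < 0 := (one_lt_norm_ratCast_iff 2 X₁).mp hX
  have h2 : 2 ∣ X₁.den := dvd_den_of_padicValRat_neg hval
  have hden := den_div_four_div_eq hd h2
  have hmul : padicLog_mul 2 := padicLog_mul_holds 2
  obtain ⟨h4, h8⟩ := padicLog_four_eq_zero_and_eight
  have hden0 : ((X₁.den : ℚ) : ℚ_[2]) ≠ 0 := by exact_mod_cast X₁.den_nz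
  have hcast : (((X₁ / 4 / (d : ℚ)).den : ℚ) : ℚ_[2]) = ((4 * d.natAbs : ℕ) : ℚ_[2]) * ((X₁.den : ℚ) : ℚ_[2]) := by
    rw [hden]; push_cast; ring
  have habs : padicLog 2 ((4 * d.natAbs : ℕ) : ℚ_[2]) = 0 := by
    rcases hd with rfl | rfl | rfl <;> norm_num [h4, h8]
  have h40 : ((4 * d.natAbs : ℕ) : ℚ_[2]) ≠ 0 := by
    rcases hd with rfl | rfl | rfl <;> norm_num
  rw [hcast, hmul h40 hden0, habs, zero_add]

end Bookkeeping

/-! ### §2 The admissible locus of the receptacle lands in the reduction-kernel locus of `W` -/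

section Locus

variable (V : WeierstrassCurve ℚ) (d : ℤ) (W : WeierstrassCurve ℚ)

/-- `v_ℓ(2) = 0` and `v_ℓ(d) = 0` for an odd prime `ℓ` and `d ∈ {−1, 2, −2}`. [folklore] -/
private theorem padicValRat_two_d_eq_zero {ℓ : ℕ} [Fact ℓ.Prime] (hℓ2 : ℓ ≠ 2) {d : ℤ}
    (hd : d = -1 ∨ d = 2 ∨ d = -2) : padicValRat ℓ (2 : ℚ) = 0 ∧ padicValRat ℓ (d : ℚ) = 0 := by
  have h2 : padicValRat ℓ (2 : ℚ) = 0 := by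
    have : padicValNat ℓ 2 = 0 := padicValNat.eq_zero_of_not_dvd fun h =>
      hℓ2 ((Nat.prime_dvd_prime_iff_eq (Fact.out : ℓ.Prime) Nat.prime_two).mp h)
    rw [show (2 : ℚ) = ((2 : ℕ) : ℚ) by norm_num, padicValRat.of_nat, this, Nat.cast_zero]
  refine ⟨h2, ?_⟩
  rcases hd with rfl | rfl | rfl
  · rw [Int.cast_neg, Int.cast_one, padicValRat.neg, padicValRat.one]
  · rw [Int.cast_ofNat]; exact h2
  · push_cast; rw [padicValRat.neg]; exact h2

/-- **The receptacle's local conditions imply non-singular reduction on the integral twist model, at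
every prime.** For `d ∈ {−1, 2, −2}`, `(2,0,0,0) • W = V^{(d)}` and a point `(X₁, Y₁) ∈ W(ℚ)` with
`‖X₁‖₂ > 1` whose `x′ = X₁/(4d)` satisfies `HasNonsingularMinusReductionAt d ℓ x′` at every odd prime `ℓ`:
`(X₁, Y₁)` has non-singular reduction on `W` at EVERY prime — at `2` because it lies in `E₁(ℚ₂)`, at odd
`ℓ` because `Φ_x = −16d²·f′(x′)`, `Φ_y = 2Y₁`, `Y₁² = 64d³·f(x′)` on `W`. [Mazur–Stein–Tate 2006, §1;
Silverman AEC VII.2, III.1] [cite: MazurSteinTate2006, §1] -/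
theorem hasNonsingularReductionAt_twistModel_of_minusTwist (hd : d = -1 ∨ d = 2 ∨ d = -2)
    (hW : (⟨Units.mk0 (2 : ℚ) two_ne_zero, 0, 0, 0⟩ : VariableChange ℚ) • W = V.quadraticTwist (d : ℚ))
    {X₁ Y₁ : ℚ} (h₁ : W.toAffine.Nonsingular X₁ Y₁) (hX : 1 < ‖(X₁ : ℚ_[2])‖)
    (hmin : ∀ ℓ : ℕ, ℓ.Prime → ℓ ≠ 2 → V.HasNonsingularMinusReductionAt (d : ℚ) ℓ (X₁ / 4 / (d : ℚ))) :
    ∀ ℓ : ℕ, ℓ.Prime → W.HasNonsingularReductionAt ℓ X₁ Y₁ := by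
  obtain ⟨ha1, ha2, ha3, ha4, ha6⟩ := V.coeffs_of_scaleTwo_smul_eq d W hW
  have hd0 : (d : ℚ) ≠ 0 := by rcases hd with rfl | rfl | rfl <;> norm_num
  intro ℓ hℓ
  haveI : Fact ℓ.Prime := ⟨hℓ⟩
  by_cases hℓ2 : ℓ = 2
  · subst hℓ2
    exact Or.inl ((one_lt_norm_ratCast_iff 2 X₁).mp hX)
  obtain ⟨hv2, hvd⟩ := padicValRat_two_d_eq_zero hℓ2 hd
  set x' : ℚ := X₁ / 4 / (d : ℚ) with hx'
  have hX₁ : X₁ = 4 * (d : ℚ) * x' := by rw [hx']; field_simp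
  -- the dictionary between `W` at `(X₁, Y₁)` and the completed cubic of `V` at `x′`
  have hΦx : W.toAffine.polynomialX.evalEval X₁ Y₁ =
      -(16 * (d : ℚ) ^ 2) * (3 * x' ^ 2 + V.b₂ / 2 * x' + V.b₄ / 2) := by
    rw [Affine.evalEval_polynomialX, ha1, ha2, ha4, hX₁]; ring
  have hΦy : W.toAffine.polynomialY.evalEval X₁ Y₁ = 2 * Y₁ := by
    rw [Affine.evalEval_polynomialY, ha1, ha3]; ring
  have heq : Y₁ ^ 2 = 64 * (d : ℚ) ^ 3 * (x' ^ 3 + V.b₂ / 4 * x' ^ 2 + V.b₄ / 2 * x' + V.b₆ / 4) := by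
    have := h₁.1
    rw [Affine.equation_iff, ha1, ha2, ha3, ha4, ha6, hX₁] at this
    linear_combination this
  have h4 : padicValRat ℓ (4 : ℚ) = 0 := by
    rw [show (4 : ℚ) = 2 ^ 2 by norm_num, padicValRat.pow, hv2, mul_zero]
  have h16 : padicValRat ℓ (-(16 * (d : ℚ) ^ 2)) = 0 := by
    rw [padicValRat.neg, padicValRat.mul (by norm_num) (pow_ne_zero 2 hd0),
      show (16 : ℚ) = 2 ^ 4 by norm_num, padicValRat.pow, padicValRat.pow, hv2, hvd]; ring
  have h64 : padicValRat ℓ (64 * (d : ℚ) ^ 3) = 0 := by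
    rw [padicValRat.mul (by norm_num) (pow_ne_zero 3 hd0), show (64 : ℚ) = 2 ^ 6 by norm_num,
      padicValRat.pow, padicValRat.pow, hv2, hvd]; ring
  have hcase := hmin ℓ hℓ hℓ2
  simp only [HasNonsingularMinusReductionAt] at hcase
  rcases hcase with hlt | ⟨hf'0, hf'v⟩ | ⟨-, hf0, hfv⟩
  · -- `x′` has negative valuation: `P′` reduces to `O`, and so does `(X₁, Y₁)`
    refine Or.inl ?_
    have hx0 : x' ≠ 0 := by rintro h; rw [h, padicValRat.zero] at hlt; exact lt_irrefl _ hlt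
    rw [hX₁, padicValRat.mul (mul_ne_zero (by norm_num) hd0) hx0, padicValRat.mul (by norm_num) hd0,
      h4, hvd]
    simpa using hlt
  · -- `f′(x′)` is an `ℓ`-unit: `Φ_x` is
    refine Or.inr (Or.inl ⟨?_, ?_⟩)
    · rw [hΦx]; exact mul_ne_zero (neg_ne_zero.mpr (mul_ne_zero (by norm_num) (pow_ne_zero 2 hd0))) hf'0
    · rw [hΦx, padicValRat.mul (neg_ne_zero.mpr (mul_ne_zero (by norm_num) (pow_ne_zero 2 hd0))) hf'0,
        h16, hf'v, add_zero]
  · -- `f(x′)` is an `ℓ`-unit: `Y₁` is, hence `Φ_y = 2Y₁` is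
    have hY0 : Y₁ ≠ 0 := by
      rintro rfl
      rw [zero_pow two_ne_zero] at heq
      exact mul_ne_zero (mul_ne_zero (by norm_num) (pow_ne_zero 3 hd0)) hf0 heq.symm
    have hvY : padicValRat ℓ Y₁ = 0 := by
      have := congrArg (padicValRat ℓ) heq
      rw [padicValRat.pow, padicValRat.mul (mul_ne_zero (by norm_num) (pow_ne_zero 3 hd0)) hf0, h64,
        hfv] at this
      simpa using this
    refine Or.inr (Or.inr ⟨?_, ?_⟩)
    · rw [hΦy]; exact mul_ne_zero two_ne_zero hY0
    · rw [hΦy, padicValRat.mul two_ne_zero hY0, hv2, hvY, add_zero]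

end Locus

/-! ### §3 The height datum on `V^{(d)}(ℚ)` pinned to `canonicalPAdicHeightSqMinusTwist` -/

section Pinning

variable (V : WeierstrassCurve ℚ) [V.IsElliptic] [V.IsIntegral ℤ] (d : ℤ)

/-- **A `2`-adic height datum on `V^{(d)}(ℚ)` equal to the minus-twist receptacle formula off the
boundary.** Let `V/ℚ` be elliptic with `ℤ`-integral equation such that `V ⊗ ℚ₂` has a sigma-squared pair
(`V` good ordinary at `2`, e.g. `cm7Twist_exists_isMazurTateSigmaSqPair_two`), and `d ∈ {−1, 2, −2}`.
Then there is a symmetric bilinear torsion-vanishing `D : V^{(d)}(ℚ) × V^{(d)}(ℚ) → ℚ₂`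
(`PAdicHeightData (V.quadraticTwist d) 2`) with
`D(P, P) = canonicalPAdicHeightSqMinusTwist V 2 d P = log₂ den x(P′) − log₂ 𝔖₂(1/x(P′))` for every
`P = (X, Y)` satisfying the receptacle's local conditions (`IsAdmissibleMinusTwist`) AND `‖4X‖₂ > 1`
(i.e. `ord₂ x(P′) ≤ −4` when `d = ±2`; automatic when `d = −1`). Construction: the integral twist model
`W = (2,0,0,0)⁻¹ • V^{(d)}` carries the sigma-squared pair `((4d)⁻¹𝔖₂(4d/x), 4d·c)`
(`isMazurTateSigmaSqPair_twistModel_padicSigmaSqInvX`), whose `Σ`-height is quadratic on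
`W(ℚ) ∩ Ŵ(2ℤ₂) ∩ ⋂_ℓ W₀` (`exists_padicHeightData_of_pair_of_a₁_a₃`) and equals the receptacle formula there
(`log₂(4|d|) = 0`, `𝔖`-value dictionary); transport along `(X, Y) ↦ (4X, 8Y)`. [Mazur–Stein–Tate 2006,
§1 eq. (1.1), §2.7; Silverman 2005, §5 Rem. 2; Balakrishnan–Çiperiani–Stein 2015, §4.1 (4.1)]
[cite: MazurSteinTate2006, §2.7] [cite: Silverman2005DivPoly, §5 Rem. 2] -/
theorem exists_padicHeightData_eq_canonicalPAdicHeightSqMinusTwist (hd : d = -1 ∨ d = 2 ∨ d = -2)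
    (hex : ∃ Sq : ℚ_[2]⟦X⟧, ∃ c : ℚ_[2], (V.baseChange ℚ_[2]).IsMazurTateSigmaSqPair Sq c) :
    ∃ D : PAdicHeightData (V.quadraticTwist (d : ℚ)) 2,
      ∀ (X Y : ℚ) (h : (V.quadraticTwist (d : ℚ)).toAffine.Nonsingular X Y),
        V.IsAdmissibleMinusTwist 2 (d : ℚ) (.some X Y h) → 1 < ‖((4 * X : ℚ) : ℚ_[2])‖ →
          D.pairing (.some X Y h) (.some X Y h) = V.canonicalPAdicHeightSqMinusTwist 2 (d : ℚ) (.some X Y h) := by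
  have hd0 : d ≠ 0 := by rcases hd with rfl | rfl | rfl <;> norm_num
  have hd0' : (d : ℚ) ≠ 0 := by exact_mod_cast hd0
  set C₂ : VariableChange ℚ := ⟨Units.mk0 (2 : ℚ) two_ne_zero, 0, 0, 0⟩ with hC₂
  set T := V.quadraticTwist (d : ℚ) with hT
  set W := C₂⁻¹ • T with hWdef
  have hW : C₂ • W = V.quadraticTwist (d : ℚ) := smul_inv_smul C₂ T
  haveI : W.IsElliptic := V.isElliptic_of_scaleTwo_smul_eq d W hd0 hW
  haveI : W.IsIntegral ℤ := V.isIntegral_of_scaleTwo_smul_eq d W hW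
  obtain ⟨ha1, -, ha3, -, -⟩ := V.coeffs_of_scaleTwo_smul_eq d W hW
  -- the pair of `W ⊗ ℚ₂` and its series
  have hpairW := V.isMazurTateSigmaSqPair_twistModel_padicSigmaSqInvX d W 2 hd0 hW hex
  set S := V.padicSigmaSqInvX 2 with hSdef
  have hSexp := isInvXExpansion_padicSigmaSqInvX_of_exists_pair (V := V) (p := 2) (Or.inr hex)
  have hpairV := isMazurTateSigmaSqPair_padicSigmaSq (W := V.baseChange ℚ_[2]) (Or.inr hex)
  have hSint : IsPadicInt S := hSexp.isPadicInt hpairV.isPadicInt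
  have hS0 : constantCoeff S = 0 := hSexp.constantCoeff_eq hpairV.constantCoeff_eq
  have hab : (4 * (d : ℚ_[2]))⁻¹ * (4 * (d : ℚ_[2])) = 1 :=
    inv_mul_cancel₀ (by rcases hd with rfl | rfl | rfl <;> norm_num)
  have hb : ‖(4 * (d : ℚ_[2]))‖ ≤ 1 := by
    rw [show (4 * (d : ℚ_[2])) = ((4 * d : ℤ) : ℚ_[2]) by push_cast; ring]
    exact Padic.norm_int_le_one _
  -- the isomorphism of points `T(ℚ) ≃ W(ℚ)`, `(X, Y) ↦ (4X, 8Y)`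
  set ψ := VariableChange.pointEquiv T C₂⁻¹ with hψ
  have htoX : ∀ X : ℚ, (C₂⁻¹).toX X = 4 * X := fun X => by
    rw [VariableChange.toX_def, hC₂, VariableChange.inv_def]; simp; norm_num
  have hofX : ∀ X₁ : ℚ, (C₂⁻¹).ofX X₁ = X₁ / 4 := fun X₁ => by
    rw [VariableChange.ofX_def, hC₂, VariableChange.inv_def]; simp; norm_num; ring
  -- the function to be pinned, read on `W`
  set q : W.toAffine.Point → ℚ_[2] := fun P₁ => V.canonicalPAdicHeightSqMinusTwist 2 (d : ℚ) (ψ.symm P₁)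
    with hqdef
  have hq0 : q 0 = 0 := by simp [hqdef]
  have hq : ∀ (X₁ Y₁ : ℚ) (h₁ : W.toAffine.Nonsingular X₁ Y₁), 1 < ‖(X₁ : ℚ_[2])‖ →
      q (.some X₁ Y₁ h₁) = padicLog 2 ((X₁.den : ℚ) : ℚ_[2]) -
        padicLog 2 (padicEval (C (4 * (d : ℚ_[2]))⁻¹ *
          S.subst (C (4 * (d : ℚ_[2])) * (W.baseChange ℚ_[2]).formalInvX)) (-(X₁ : ℚ_[2]) / Y₁)) := by
    intro X₁ Y₁ h₁ hX₁
    have hX0 : (X₁ : ℚ_[2]) ≠ 0 := by rintro h; rw [h, norm_zero] at hX₁; exact not_lt.mpr zero_le_one hX₁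
    -- the value of the twisted pair
    have hval := padicEval_rescale_subst_formalInvX_eq (V₂ := W.baseChange ℚ_[2]) hSint hS0 hab hb
      (nonsingular_ratCast (p := 2) h₁).1 hX₁
    have hne := W.padicEval_pair_param_ne_zero 2 hpairW h₁ hX₁
    rw [hval] at hne ⊢
    have hSv : padicEval S (4 * (d : ℚ_[2]) * (X₁ : ℚ_[2])⁻¹) ≠ 0 := fun h => hne (by rw [h, mul_zero])
    -- the receptacle formula at `ψ⁻¹(X₁, Y₁) = (X₁/4, Y₁/8)`
    simp only [hqdef]
    rw [hψ, VariableChange.pointEquiv_symm_apply, VariableChange.pointInv_some,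
      canonicalPAdicHeightSqMinusTwist_some, hofX, padicLog_den_div_four_div_eq hd hX₁,
      padicLog_inv_four_mul_mul hd hSv]
    congr 2
    unfold padicSigmaSqInvXEval
    congr 1
    push_cast
    field_simp
  obtain ⟨D₁, hD₁⟩ := W.exists_padicHeightData_of_pair_of_a₁_a₃ 2 ha1 ha3 hpairW q hq0 hq
  -- transport along `ψ`
  refine ⟨{ pairing := (D₁.pairing.compl₂ ψ.toAddMonoidHom).comp ψ.toAddMonoidHom
            symm := fun P Q => D₁.symm _ _
            map_torsion := fun P Q hP => D₁.map_torsion _ _ (ψ.toAddMonoidHom.isOfFinAddOrder hP) },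
    fun X Y h hadm hX4 => ?_⟩
  show D₁.pairing (ψ (.some X Y h)) (ψ (.some X Y h)) = _
  have hψP := VariableChange.pointEquiv_some T C₂⁻¹ h
  rw [← hψ] at hψP
  -- the local conditions of the receptacle
  obtain ⟨-, hloc⟩ := hadm
  obtain ⟨-, -, hmin, -⟩ : V.MinusTwistLocalConditions 2 (d : ℚ) (.some X Y h) := hloc
  have hX₁ : 1 < ‖(((C₂⁻¹).toX X : ℚ) : ℚ_[2])‖ := by rw [htoX]; exact_mod_cast hX4
  have hmin' : ∀ ℓ : ℕ, ℓ.Prime → ℓ ≠ 2 →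
      V.HasNonsingularMinusReductionAt (d : ℚ) ℓ ((C₂⁻¹).toX X / 4 / (d : ℚ)) := fun ℓ hℓ hℓ2 => by
    rw [htoX, show (4 * X / 4 / (d : ℚ)) = X / d by field_simp]
    exact hmin ℓ hℓ hℓ2 hℓ2
  have hns := V.hasNonsingularReductionAt_twistModel_of_minusTwist d W hd hW
    ((VariableChange.nonsingular_iff T C₂⁻¹ X Y).mpr h) hX₁ hmin'
  rw [hψP, hD₁ _ _ _ hX₁ hns]
  simp only [hqdef]
  rw [← hψP, AddEquiv.symm_apply_apply]

/-- **At `d = −1` this IS the receptacle `IsCanonicalSqMinusTwist`**: for `V/ℚ` elliptic, `ℤ`-integral,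
with a sigma-squared pair at `2`, there is a `2`-adic height datum `D` on `V^{(−1)}(ℚ)` with
`D.IsCanonicalSqMinusTwist` — on EVERY admissible point `⟨P,P⟩_D = log₂ den x(P′) − log₂ 𝔖₂(1/x(P′))`
(admissibility gives `‖x(P′)‖₂ > 4`, i.e. `‖4X‖₂ > 1`). So the `∀ D, IsCanonicalSqMinusTwist D → …`
statements at `d = −1` (Bertrand's non-vanishing on the minus part,
`bertrand_pairingSqMinusTwist_self_ne_zero_two`) are about an object that exists.
[Mazur–Stein–Tate 2006, §1, §2.7; Silverman 2005, §5 Rem. 2] [cite: MazurSteinTate2006, §2.7]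
[cite: Silverman2005DivPoly, §5 Rem. 2] -/
theorem exists_isCanonicalSqMinusTwist_neg_one
    (hex : ∃ Sq : ℚ_[2]⟦X⟧, ∃ c : ℚ_[2], (V.baseChange ℚ_[2]).IsMazurTateSigmaSqPair Sq c) :
    ∃ D : PAdicHeightData (V.quadraticTwist ((-1 : ℤ) : ℚ)) 2, D.IsCanonicalSqMinusTwist := by
  obtain ⟨D, hD⟩ := V.exists_padicHeightData_eq_canonicalPAdicHeightSqMinusTwist (-1) (Or.inl rfl) hex
  refine ⟨D, fun P hP => ?_⟩
  rcases P with _ | ⟨X, Y, h⟩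
  · exact (V.not_isAdmissibleMinusTwist_zero 2 ((-1 : ℤ) : ℚ) hP).elim
  refine hD X Y h hP ?_
  obtain ⟨-, hloc⟩ := hP
  obtain ⟨hx1, hdisc, -, -⟩ : V.MinusTwistLocalConditions 2 ((-1 : ℤ) : ℚ) (.some X Y h) := hloc
  -- `‖(−X)⁻¹‖ < 2^{-2}` gives `‖X‖ > 4`, i.e. `‖4X‖ = ‖X‖/4 > 1`
  have hrad : ((2 : ℕ) : ℝ) ^ (-(2 / (((2 : ℕ) : ℝ) - 1))) = 4⁻¹ := by
    rw [show (-(2 / (((2 : ℕ) : ℝ) - 1))) = ((-2 : ℤ) : ℝ) by norm_num, Real.rpow_intCast]; norm_num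
  rw [hrad] at hdisc
  have hX : (((X / ((-1 : ℤ) : ℚ) : ℚ)) : ℚ_[2]) = -(X : ℚ_[2]) := by push_cast; ring
  rw [hX, norm_inv, norm_neg] at hdisc
  have hXpos : 0 < ‖(X : ℚ_[2])‖ := by
    rw [hX, norm_neg] at hx1; exact one_pos.trans hx1
  have h4 : ‖((4 * X : ℚ) : ℚ_[2])‖ = 4⁻¹ * ‖(X : ℚ_[2])‖ := by
    push_cast
    rw [norm_mul, show ((4 : ℚ_[2])) = ((2 : ℕ) : ℚ_[2]) ^ 2 by norm_num, norm_pow, Padic.norm_p]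
    norm_num
  rw [h4]
  have := (inv_lt_comm₀ hXpos (by norm_num)).mp hdisc
  nlinarith

end Pinning

end WeierstrassCurve
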